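import Summits.PneNP.PneNP.Theorems.ConstantBand.Negative.LoadBearing

/-!
# `ConstantBand` (stmt-PneNP-2834) — negative-side lemmas: the witness `k` must grow with the exponent `c`

* `exists_exact_monotone_cliqueFn` — the monotone DNF with its gate count: for `2 ≤ k ≤ n` a circuit over `{∧₂, ∨₂}`
  of size `≤ C(n,k)·C(n,2) + C(n,k)` computes CLIQUE_k exactly (so the hypothesis class of the crux is inhabited:
  `exists_monotone_bandErr_zero` — the crux is not vacuously true).
* `not_bandLB_of_le` — for `2 ≤ k`, `k + 3 ≤ c`, `0 ≤ δ`: `BandLB c k w δ` is FALSE (brute force has `≤ n^{k+3}` gates).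
* `not_exists_k_forall_c` — the natural strengthening "one `k` for every `c`" of `ConstantBand` is FALSE.
* `le_of_bandLB` — in any witness `(k, w, δ)` for exponent `c`: `c ≤ k + 2`.

Refuter seat cdisprove-stmt-PneNP-2834 (gen 1), 2026-08-16.
-/

set_option linter.dupNamespace false

namespace Summit.PneNP.PneNP.Theorems.ConstantBand.Negative

open Literature.Computability.Complexity Filter Finset Classical
open Summit.PneNP.PneNP.Theses.OneSlice (ConstantBand)

/-! ## §3 The witness `k` must grow with `c` (exact DNF; "one `k` for all `c`" is false) -/

/-- **The monotone DNF with its size.** For `2 ≤ k ≤ n` the OR over all `k`-sets of the AND of their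
edges is a circuit over `{∧₂, ∨₂}` of size `≤ C(n,k)·C(n,2) + C(n,k)` computing `CLIQUE_k` exactly
(the construction of `exists_monotone_computes_cliqueFn_holds`, with the gate count kept). [folklore] -/
theorem exists_exact_monotone_cliqueFn {n k : ℕ} (h2 : 2 ≤ k) (hkn : k ≤ n) :
    ∃ C : Circuit (Edge n), C.IsOver monotoneBasis ∧
      C.size ≤ n.choose k * n.choose 2 + n.choose k ∧ ∀ x, C.eval x = cliqueFn n k x := by
  set T : Finset (Finset (Fin n)) := powersetCard k univ with hT
  let E : Finset (Fin n) → List (Edge n) := fun S => (univ.filter fun e => IsLive S e).toList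
  have hEne : ∀ S ∈ T, E S ≠ [] := by
    intro S hS
    have hScard : #S = k := (mem_powersetCard.1 hS).2
    obtain ⟨u, hu, v, hv, huv⟩ := one_lt_card.1 (by omega : 1 < #S)
    have he : s(u, v) ∈ (⊤ : SimpleGraph (Fin n)).edgeSet := (SimpleGraph.mem_edgeSet _).2 huv
    intro hnil
    have : (⟨s(u, v), he⟩ : Edge n) ∈ E S :=
      Finset.mem_toList.2 (mem_filter.2 ⟨mem_univ _, (isLive_mk he).2 ⟨hu, hv⟩⟩)
    rw [hnil] at this
    simp at this
  have hTne : T.toList ≠ [] := by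
    intro hnil
    have hne : T.Nonempty := powersetCard_nonempty.2 (by simpa using hkn)
    obtain ⟨S, hS⟩ := hne
    have := Finset.mem_toList.2 hS
    rw [hnil] at this
    simp at this
  have hElen : ∀ S, (E S).length ≤ n.choose 2 := by
    intro S
    show (Finset.toList _).length ≤ _
    rw [Finset.length_toList, ← card_edgeSet_top_fin n, ← card_univ]
    exact card_le_card (filter_subset _ _)
  -- stage 1: all the ANDs in parallel
  have h1 : CktSize monotoneBasis
      (fun (x : Edge n → Bool) (S : T) => (E S).all fun e => x e) (∑ S : T, (E S).length) :=
    CktSize.pi fun S => cktSize_all (E S) (hEne S S.2)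
  -- stage 2: the OR of the results
  have hUne : (univ : Finset T).toList ≠ [] := by
    intro hnil
    obtain ⟨S, hS⟩ := List.exists_mem_of_ne_nil T.toList hTne
    have := Finset.mem_toList.2 (mem_univ (⟨S, Finset.mem_toList.1 hS⟩ : T))
    rw [hnil] at this
    simp at this
  have h12 := h1.comp (cktSize_any (ι := T) (univ : Finset T).toList hUne)
  obtain ⟨C, hCB, hs, hCev⟩ := h12.toCircuit
  refine ⟨C, hCB, hs.trans ?_, fun x => ?_⟩
  · -- size bookkeeping
    have hTcard : Fintype.card T = n.choose k := by
      rw [Fintype.card_coe, hT, card_powersetCard, card_univ, Fintype.card_fin]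
    have hsum : ∑ S : T, (E S).length ≤ n.choose k * n.choose 2 :=
      calc ∑ S : T, (E S).length ≤ ∑ _S : T, n.choose 2 := sum_le_sum fun S _ => hElen S
        _ = n.choose k * n.choose 2 := by rw [sum_const, smul_eq_mul, card_univ, hTcard]
    have hlen : (univ : Finset T).toList.length = n.choose k := by
      rw [Finset.length_toList, card_univ, hTcard]
    omega
  · rw [hCev]
    apply Bool.eq_iff_iff.2
    rw [cliqueFn_eq_true_iff_exists, List.any_eq_true]
    constructor
    · rintro ⟨S, -, hS⟩
      rw [List.all_eq_true] at hS
      refine ⟨S, (mem_powersetCard.1 S.2).2, fun e he => hS e ?_⟩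
      exact Finset.mem_toList.2 (mem_filter.2 ⟨mem_univ _, he⟩)
    · rintro ⟨S, hS, hx⟩
      have hST : S ∈ T := mem_powersetCard.2 ⟨subset_univ _, hS⟩
      refine ⟨⟨S, hST⟩, Finset.mem_toList.2 (mem_univ _), ?_⟩
      rw [List.all_eq_true]
      intro e he
      exact hx e (mem_filter.1 (Finset.mem_toList.1 he)).2

/-- The hypothesis class of the crux is inhabited at every `n ≥ k ≥ 2`: some monotone circuit has band
error `0` (so the crux is not vacuously true; its content is the size bound). [folklore] -/
theorem exists_monotone_bandErr_zero {n k : ℕ} (h2 : 2 ≤ k) (hkn : k ≤ n) (j w : ℕ) :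
    ∃ C : Circuit (Edge n), C.IsOver monotoneBasis ∧ bandErr n k j w C = 0 ∧
      C.size ≤ n.choose k * n.choose 2 + n.choose k := by
  obtain ⟨C, hCB, hs, he⟩ := exists_exact_monotone_cliqueFn h2 hkn
  exact ⟨C, hCB, bandErr_eq_zero_of_eval fun x _ => he x, hs⟩

/-- **Small `k` is refuted by brute force**: for `2 ≤ k`, `k + 3 ≤ c` and any `δ ≥ 0`, `BandLB c k w δ`
is FALSE (the exact DNF has `≤ C(n,k)·C(n,2) + C(n,k) ≤ 2 n^{k+2} < n^{k+3} ≤ n^c` gates). [folklore] -/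
theorem not_bandLB_of_le {c k w : ℕ} {δ : ℝ} (h2 : 2 ≤ k) (hc : k + 3 ≤ c) (hδ : 0 ≤ δ) :
    ¬ BandLB c k w δ := by
  intro H
  obtain ⟨n, hn, hnk⟩ := (H.and (eventually_ge_atTop (k + 3))).exists
  obtain ⟨C, hCB, hs, he⟩ := exists_exact_monotone_cliqueFn h2 (by omega : k ≤ n)
  have hlt := hn (thr k n) (central_thr k n) C hCB
    (by rw [bandErr_eq_zero_of_eval fun x _ => he x]; exact hδ)
  -- `C(n,k)·C(n,2) + C(n,k) ≤ n^k n^2 + n^k ≤ 2 n^(k+2) ≤ n^(k+3) ≤ n^c`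
  have hk' : n.choose k ≤ n ^ k := Nat.choose_le_pow n k
  have h2' : n.choose 2 ≤ n ^ 2 := Nat.choose_le_pow n 2
  have hA : n.choose k * n.choose 2 + n.choose k ≤ n ^ k * n ^ 2 + n ^ k :=
    add_le_add (Nat.mul_le_mul hk' h2') hk'
  have hB : n ^ k * n ^ 2 + n ^ k ≤ 2 * n ^ (k + 2) := by
    rw [pow_add]
    have : n ^ k ≤ n ^ k * n ^ 2 := Nat.le_mul_of_pos_right _ (Nat.pow_pos (by omega))
    omega
  have hC : 2 * n ^ (k + 2) ≤ n ^ (k + 3) := by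
    rw [show n ^ (k + 3) = n ^ (k + 2) * n from pow_succ n (k + 2), mul_comm]
    exact Nat.mul_le_mul_left _ (by omega)
  have hD : n ^ (k + 3) ≤ n ^ c := Nat.pow_le_pow_right (by omega) hc
  omega

/-- **The natural strengthening "one `k` for every `c`" is FALSE.** [folklore] -/
theorem not_exists_k_forall_c :
    ¬ ∃ k : ℕ, 3 ≤ k ∧ ∀ c : ℕ, ∃ w : ℕ, ∃ δ : ℝ, 0 < δ ∧ BandLB c k w δ := by
  rintro ⟨k, hk, h⟩
  obtain ⟨w, δ, hδ, H⟩ := h (k + 3)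
  exact not_bandLB_of_le (by omega) le_rfl hδ.le H

/-- **In any proof the exponent is at most `k + 2`**: a witness `(k, w, δ)` for `c` has `c ≤ k + 2`. [folklore] -/
theorem le_of_bandLB {c k w : ℕ} {δ : ℝ} (hk : 2 ≤ k) (hδ : 0 ≤ δ) (H : BandLB c k w δ) :
    c ≤ k + 2 := by
  by_contra hc
  exact not_bandLB_of_le hk (by omega) hδ H

end Summit.PneNP.PneNP.Theorems.ConstantBand.Negative
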